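import Literature.Geometry.Lorentzian.TeukolskyRadialHeunForm
import Literature.Geometry.Lorentzian.KerrTortoiseRadius
import Mathlib.Analysis.SpecialFunctions.Sqrt
import HarnessLib

/-!
# The intertwined confluent Heun operator `𝒯̃` of Whiting's transformation and its Liouville
# normal form `ũ'' + Ṽ ũ = 0` (Teixeira da Costa 2020, §3.2, Prop. 3.8 (2) and Remark 3.9 (iv))

Third file of the proof programme for the named fact
`Literature.Geometry.Lorentzian.Kerr.Costa2019_realAxisModeStability` (R. Teixeira da Costa,
Commun. Math. Phys. 378 (2020) 705–781 = arXiv:1910.02854 [Costa2019], Thm. 4.1), continuing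
`TeukolskyRadialHeunForm.lean`. In the source (§3.2.2) the transform `g̃` of the auxiliary
function `g` satisfies `𝒯̃_x g̃ = 0` for "another confluent Heun operator with different
parameters", `𝒯̃_x = Δ_x ∂ₓ² + P̃ ∂ₓ + Q̃`, and (proof of Prop. 3.8, §3.2.4) the rescaled
function `ũ = (x²+a²)^{1/2}(x−r₋)^{−s}(x−r₊)^{ξ+η} e^{γx} g̃` satisfies, in the tortoise variable
`dx*/dx = (x²+a²)/Δ_x`, the wave equation `ũ'' + Ṽ ũ = 0` with a potential which is REAL for
real `ω` (Remark 3.9 (iv), the input of the `T`-current argument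
`Costa2019.transformedSolution_eq_zero`). This file provides that algebra, all proved:

* `Costa2019.heunPt`, `Costa2019.heunQt` — the coefficients `P̃`, `Q̃` of `𝒯̃` (as polynomials of
  a complex variable, for use with the kernel at `z = x + iy`);
* `Costa2019.tortoiseH` (`h = Δ/(x²+a²)`, so `d/dx* = h d/dx`), `tortoiseHDeriv`,
  `Costa2019.liouvilleMu` (`μ = (x²+a²)^{1/2}(x−r₋)^{−s}(x−r₊)^{−2iMω}e^{−iωx}`, using
  `ξ + η = −2iMω`, `horizonExponent_add_innerExponent`), its logarithmic derivative
  `liouvilleNu` (`ν`) and `liouvilleNuDeriv` (`ν'`), with the `HasDerivAt` lemmas;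
* `Costa2019.whitingPotentialC := −h[h'ν + h(ν' + ν² − Q̃/Δ)]`, the Liouville potential, and
  **its reality** `conj_whitingPotentialC` (an algebraic identity: complex conjugation flips the
  sign of `i` in `ν`, `Q̃`, and the resulting rational function is even in `i`), whence the
  real-valued `Costa2019.whitingPotential` with `ofReal_whitingPotential`;
* the first-order cancellation `h' + h(2ν − P̃/Δ) = 0` (`tortoiseHDeriv_add_eq_zero`, i.e.
  `h'/h + 2μ'/μ = P̃/Δ`, which is what the choice of `μ` achieves), and
* **the Liouville normal form** `liouville_normal_form`: if `Δ G'' + P̃ G' + Q̃ G = 0` at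
  `x > r₊` then `u = μ G` satisfies `h (h u')' + Ṽ u = 0` there; and its pull-back to the
  tortoise variable `x*` along a tortoise radius function `x = R(x*)`
  (`Kerr.IsTortoiseRadius`, `dR/dx* = h(R)`): `hasDerivAt_comp_tortoise` (chain rule) and
  `transformed_equation_tortoise` (`v = (μG) ∘ R` satisfies `v'' + Ṽ(R) v = 0`, the equation of
  Prop. 3.8 (2) "with respect to `x* ∈ (−∞, ∞)`", ready for
  `Costa2019.transformedSolution_eq_zero`).

**Errata (recorded, see also `TeukolskyRadialHeunForm.lean`).** (i) The constant term of `Q̃` is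
`2γ(1−2s)r₋ − 2s − L` (source: `2γ(1−s)r₋`), forced by the corrected `𝒯_r`; (ii) the source's
display (subextremal-transformation) omits the factor `e^{γx} = e^{−iωx}` in `ũ` (present in
Shlapentokh-Rothman 2015 and required both for the cancellation `tortoiseHDeriv_add_eq_zero` and
for the boundary behaviour `ũ' − iωũ = O(x⁻¹)` of Prop. 3.8 (4)); `liouvilleMu` includes it.
With (i) and (ii) the potential is real (`conj_whitingPotentialC`), as Remark 3.9 (iv) states;
with the printed constant it is not (for `s ≠ 0`).

## References
* R. Teixeira da Costa, CMP 378 (2020) 705–781, arXiv:1910.02854, §3.2.2, §3.2.4, Rmk 3.9.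
  [Costa2019]
* Y. Shlapentokh-Rothman, Ann. Henri Poincaré 16 (2015) 289–345, §4. [ShlapentokhRothman2015ModeStability]
-/

noncomputable section

open Complex Set ComplexConjugate

namespace Literature.Geometry.Lorentzian.Kerr

namespace Costa2019

/-! ### The coefficients of `𝒯̃` -/

/-- The first-order coefficient of `𝒯̃_z`:
`P̃(z) = (1 − 2s)(z − r₊) + (1 + 2ξ + 2η)(z − r₋) + 2γΔ_z`, `Δ_z = (z − r₊)(z − r₋)`, `γ = −iω`.
[cite: Costa2019, §3.2.2 (confluent-operator-tilde)] -/
def heunPt (M a s ω m : ℝ) (z : ℂ) : ℂ :=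
  (1 - 2 * (s : ℂ)) * (z - rPlus M a) +
    (1 + 2 * horizonExponent M a ω m + 2 * innerExponent M a ω m) * (z - rMinus M a) +
    2 * (-I * ω) * ((z - rPlus M a) * (z - rMinus M a))

/-- The zeroth-order coefficient of `𝒯̃_z`:
`Q̃(z) = 2γ(2η + 1 − s)(z − r₋) + 2γ(1 − 2s) r₋ − 2s − L` (`γ = −iω`, `L = λ + a²ω² − 2amω`;
corrected constant, see the module docstring — the source has `2γ(1−s)r₋`).
[cite: Costa2019, §3.2.2 (confluent-operator-tilde), corrected] -/
def heunQt (M a s ω m lam : ℝ) (z : ℂ) : ℂ :=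
  2 * (-I * ω) * (2 * innerExponent M a ω m + 1 - s) * (z - rMinus M a) +
    2 * (-I * ω) * (1 - 2 * (s : ℂ)) * rMinus M a - 2 * s -
    ((lam + a ^ 2 * ω ^ 2 - 2 * a * m * ω : ℝ) : ℂ)

/-- `ξ + η = −2iMω`. [cite: Costa2019, §3.2 (def-eta-xi-gamma)] -/
theorem horizonExponent_add_innerExponent {M a : ℝ} (hM : 0 < M) (ha : |a| < M) (ω m : ℝ) :
    horizonExponent M a ω m + innerExponent M a ω m = -(2 * I * M * ω) := by
  have h3 : (rPlus M a : ℂ) - (rMinus M a : ℂ) ≠ 0 := by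
    rw [← Complex.ofReal_sub]
    exact_mod_cast (sub_pos.2 (IsSubextremal.rMinus_lt_rPlus ha)).ne'
  unfold innerExponent
  rw [horizonExponent_eq hM ha]
  push_cast
  field_simp
  ring

/-! ### The tortoise factor `h = Δ/(x² + a²)` -/

/-- `h(x) = Δ(x)/(x² + a²)`, the factor of `d/dx* = h d/dx` for the tortoise variable
`dx*/dx = (x² + a²)/((x − r₋)(x − r₊))` of Prop. 3.8. [cite: Costa2019, Prop. 3.8] -/
def tortoiseH (M a : ℝ) (x : ℝ) : ℝ := delta M a x / (x ^ 2 + a ^ 2)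

/-- `h'(x) = [2(x − M)(x² + a²) − 2xΔ]/(x² + a²)²`. [cite: Costa2019, Prop. 3.8] -/
def tortoiseHDeriv (M a : ℝ) (x : ℝ) : ℝ :=
  (2 * (x - M) * (x ^ 2 + a ^ 2) - 2 * x * delta M a x) / (x ^ 2 + a ^ 2) ^ 2

/-- `h' ` is the derivative of `h` wherever `x² + a² ≠ 0`. [folklore] -/
theorem hasDerivAt_tortoiseH (M a : ℝ) {x : ℝ} (hx : x ^ 2 + a ^ 2 ≠ 0) :
    HasDerivAt (tortoiseH M a) (tortoiseHDeriv M a x) x := by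
  have h1 := hasDerivAt_delta M a x
  have h2 : HasDerivAt (fun x : ℝ => x ^ 2 + a ^ 2) (2 * x) x := by
    simpa using ((hasDerivAt_id x).pow 2).add_const (a ^ 2)
  have h := h1.div h2 hx
  refine h.congr_deriv ?_
  unfold tortoiseHDeriv
  ring

/-! ### The Liouville factor `μ` and its logarithmic derivative `ν` -/

/-- `ν = μ'/μ = x/(x²+a²) − s/(x − r₋) − 2iMω/(x − r₊) − iω`.
[cite: Costa2019, §3.2.4 (derivative-u-tilde-sub)] -/
def liouvilleNu (M a s ω : ℝ) (x : ℝ) : ℂ :=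
  (x : ℂ) / ((x ^ 2 + a ^ 2 : ℝ) : ℂ) - (s : ℂ) / ((x - rMinus M a : ℝ) : ℂ) -
    2 * I * M * ω / ((x - rPlus M a : ℝ) : ℂ) - I * ω

/-- `ν' = (a² − x²)/(x²+a²)² + s/(x − r₋)² + 2iMω/(x − r₊)²`.
[cite: Costa2019, §3.2.4] -/
def liouvilleNuDeriv (M a s ω : ℝ) (x : ℝ) : ℂ :=
  ((a ^ 2 - x ^ 2 : ℝ) : ℂ) / ((x ^ 2 + a ^ 2 : ℝ) : ℂ) ^ 2 + (s : ℂ) / ((x - rMinus M a : ℝ) : ℂ) ^ 2 +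
    2 * I * M * ω / ((x - rPlus M a : ℝ) : ℂ) ^ 2

/-- The Liouville factor `μ = (x² + a²)^{1/2} (x − r₋)^{−s} (x − r₊)^{−2iMω} e^{−iωx}`
(`= (x²+a²)^{1/2}(x−r₋)^{−s}(x−r₊)^{ξ+η}e^{γx}`, `ξ + η = −2iMω`, `γ = −iω`), so that
`ũ = μ g̃`. [cite: Costa2019, §3.2 (subextremal-transformation) and §3.2.4, with the factor
`e^{γx}` restored (module docstring, erratum (ii))] -/
def liouvilleMu (M a s ω : ℝ) (x : ℝ) : ℂ :=
  ((Real.sqrt (x ^ 2 + a ^ 2) : ℝ) : ℂ) * ((x - rMinus M a : ℝ) : ℂ) ^ (-(s : ℂ)) *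
    ((x - rPlus M a : ℝ) : ℂ) ^ (-(2 * I * M * ω)) * Complex.exp (-(I * ω * x))

/-- `ν'` is the derivative of `ν` on `(r₊, ∞)` (`M > 0`, so `x > 0` there and `x² + a² > 0`).
[cite: Costa2019, §3.2.4] -/
theorem hasDerivAt_liouvilleNu {M : ℝ} (hM : 0 < M) (a s ω : ℝ) {x : ℝ} (hr : rPlus M a < x) :
    HasDerivAt (liouvilleNu M a s ω) (liouvilleNuDeriv M a s ω x) x := by
  have hq : rMinus M a < x := (rMinus_le_rPlus M a).trans_lt hr
  have hx0 : 0 < x := (rPlus_pos hM a).trans hr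
  have hX : x ^ 2 + a ^ 2 ≠ 0 := by positivity
  have hXc : ((x ^ 2 + a ^ 2 : ℝ) : ℂ) ≠ 0 := by exact_mod_cast hX
  -- `x/(x²+a²)`
  have hX' : HasDerivAt (fun y : ℝ => ((y ^ 2 + a ^ 2 : ℝ) : ℂ)) (((2 * x : ℝ) : ℂ)) x := by
    have h := ((hasDerivAt_id x).pow 2).add_const (a ^ 2)
    simpa using h.ofReal_comp
  have hnum : HasDerivAt (fun y : ℝ => (y : ℂ)) (((1 : ℝ) : ℂ)) x := (hasDerivAt_id x).ofReal_comp
  have h1 := hnum.div hX' hXc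
  -- the two poles
  have hA := (hasDerivAt_ofReal_sub_inv (rMinus M a) hq).const_mul (s : ℂ)
  have hB := (hasDerivAt_ofReal_sub_inv (rPlus M a) hr).const_mul (2 * I * M * ω)
  have h := ((h1.sub hA).sub hB).sub_const (I * ω)
  have hfun : liouvilleNu M a s ω = fun y : ℝ =>
      ((y : ℝ) : ℂ) / ((y ^ 2 + a ^ 2 : ℝ) : ℂ) - (s : ℂ) * (((y - rMinus M a : ℝ) : ℂ))⁻¹ -
        2 * I * M * ω * (((y - rPlus M a : ℝ) : ℂ))⁻¹ - I * ω := by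
    funext y
    simp only [liouvilleNu, div_eq_mul_inv]
  rw [hfun]
  refine h.congr_deriv ?_
  have hx1 : (x : ℂ) - (rPlus M a : ℂ) ≠ 0 := by
    rw [← Complex.ofReal_sub]; exact_mod_cast (sub_pos.2 hr).ne'
  have hx2 : (x : ℂ) - (rMinus M a : ℂ) ≠ 0 := by
    rw [← Complex.ofReal_sub]; exact_mod_cast (sub_pos.2 hq).ne'
  have hX2 : (x : ℂ) ^ 2 + (a : ℂ) ^ 2 ≠ 0 := by exact_mod_cast hX
  simp only [liouvilleNuDeriv, div_eq_mul_inv]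
  push_cast
  field_simp
  ring

/-- `μ ≠ 0` on `(r₊, ∞)`. [folklore] -/
theorem liouvilleMu_ne_zero {M : ℝ} (hM : 0 < M) (a s ω : ℝ) {x : ℝ} (hr : rPlus M a < x) :
    liouvilleMu M a s ω x ≠ 0 := by
  have hq : rMinus M a < x := (rMinus_le_rPlus M a).trans_lt hr
  have hx0 : 0 < x := (rPlus_pos hM a).trans hr
  have h1 : ((Real.sqrt (x ^ 2 + a ^ 2) : ℝ) : ℂ) ≠ 0 := by
    exact_mod_cast (Real.sqrt_pos.2 (by positivity)).ne'
  have h2 : ((x - rMinus M a : ℝ) : ℂ) ≠ 0 := by exact_mod_cast (sub_pos.2 hq).ne'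
  have h3 : ((x - rPlus M a : ℝ) : ℂ) ≠ 0 := by exact_mod_cast (sub_pos.2 hr).ne'
  unfold liouvilleMu
  refine mul_ne_zero (mul_ne_zero (mul_ne_zero h1 ?_) ?_) (Complex.exp_ne_zero _)
  · exact fun h => h2 ((Complex.cpow_eq_zero_iff _ _).1 h).1
  · exact fun h => h3 ((Complex.cpow_eq_zero_iff _ _).1 h).1

/-- `μ' = μ ν` on `(r₊, ∞)`. [cite: Costa2019, §3.2.4 (derivative-u-tilde-sub)] -/
theorem hasDerivAt_liouvilleMu {M : ℝ} (hM : 0 < M) (a s ω : ℝ) {x : ℝ} (hr : rPlus M a < x) :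
    HasDerivAt (liouvilleMu M a s ω) (liouvilleMu M a s ω x * liouvilleNu M a s ω x) x := by
  have hq : rMinus M a < x := (rMinus_le_rPlus M a).trans_lt hr
  have hx0 : 0 < x := (rPlus_pos hM a).trans hr
  have hXpos : 0 < x ^ 2 + a ^ 2 := by positivity
  have hsq : Real.sqrt (x ^ 2 + a ^ 2) ≠ 0 := (Real.sqrt_pos.2 hXpos).ne'
  -- `√(x²+a²)`
  have hS : HasDerivAt (fun y : ℝ => ((Real.sqrt (y ^ 2 + a ^ 2) : ℝ) : ℂ))
      (((x / Real.sqrt (x ^ 2 + a ^ 2) : ℝ) : ℂ)) x := by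
    have h1 : HasDerivAt (fun y : ℝ => y ^ 2 + a ^ 2) (2 * x) x := by
      simpa using ((hasDerivAt_id x).pow 2).add_const (a ^ 2)
    have h2 := h1.sqrt hXpos.ne'
    have h3 : HasDerivAt (fun y : ℝ => Real.sqrt (y ^ 2 + a ^ 2)) (x / Real.sqrt (x ^ 2 + a ^ 2)) x :=
      h2.congr_deriv (by field_simp)
    exact h3.ofReal_comp
  have hA := hasDerivAt_ofReal_sub_cpow (rMinus M a) (-(s : ℂ)) hq
  have hB := hasDerivAt_ofReal_sub_cpow (rPlus M a) (-(2 * I * M * ω)) hr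
  have hE : HasDerivAt (fun y : ℝ => Complex.exp (-(I * ω * y)))
      (Complex.exp (-(I * ω * x)) * (-(I * ω))) x := by
    have h1 : HasDerivAt (fun y : ℝ => -(I * ω * (y : ℂ))) (-(I * ω * (1 : ℝ))) x :=
      ((hasDerivAt_id x).ofReal_comp.const_mul (I * ω)).neg
    simpa using h1.cexp
  refine (((hS.mul hA).mul hB).mul hE).congr_deriv ?_
  simp only [Pi.mul_apply, liouvilleMu, liouvilleNu]
  have hsqc : ((Real.sqrt (x ^ 2 + a ^ 2) : ℝ) : ℂ) ≠ 0 := by exact_mod_cast hsq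
  have hXc : ((x ^ 2 + a ^ 2 : ℝ) : ℂ) ≠ 0 := by exact_mod_cast hXpos.ne'
  have hkey : (((x / Real.sqrt (x ^ 2 + a ^ 2) : ℝ) : ℂ)) =
      ((Real.sqrt (x ^ 2 + a ^ 2) : ℝ) : ℂ) * ((x : ℂ) / ((x ^ 2 + a ^ 2 : ℝ) : ℂ)) := by
    have hreal : x / Real.sqrt (x ^ 2 + a ^ 2) =
        Real.sqrt (x ^ 2 + a ^ 2) * (x / (x ^ 2 + a ^ 2)) := by
      calc x / Real.sqrt (x ^ 2 + a ^ 2) = x * (1 / Real.sqrt (x ^ 2 + a ^ 2)) := by ring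
        _ = x * (Real.sqrt (x ^ 2 + a ^ 2) / (x ^ 2 + a ^ 2)) := by rw [Real.sqrt_div_self']
        _ = Real.sqrt (x ^ 2 + a ^ 2) * (x / (x ^ 2 + a ^ 2)) := by ring
    rw [hreal]
    push_cast
    ring
  rw [hkey]
  ring

/-! ### The Liouville potential `Ṽ` and its reality -/

/-- The Liouville potential of the transformed equation, complex form:
`Ṽ = −h [ h'ν + h (ν' + ν² − Q̃/Δ) ]` (`h = Δ/(x²+a²)`, `ν = μ'/μ`), so that
`h (h (μ g̃)')' + Ṽ μ g̃ = 0` whenever `𝒯̃ g̃ = 0` (`liouville_normal_form`).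
[cite: Costa2019, Prop. 3.8 (2), (V-tilde-sub) — derived here rather than transcribed] -/
def whitingPotentialC (M a s ω m lam : ℝ) (x : ℝ) : ℂ :=
  -(tortoiseH M a x : ℂ) * ((tortoiseHDeriv M a x : ℂ) * liouvilleNu M a s ω x +
    (tortoiseH M a x : ℂ) * (liouvilleNuDeriv M a s ω x + liouvilleNu M a s ω x ^ 2 -
      heunQt M a s ω m lam x / (delta M a x : ℂ)))

set_option maxRecDepth 8000 in
/-- **`Ṽ` is real for real `ω`** (TdC Remark 3.9 (iv): "`Ṽ` is real whenever `ω` is real").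
Complex conjugation flips the sign of `i` in `ν`, `ν'`, `Q̃` (all other entries are real), and
the rational function `Ṽ` is even in `i`. [cite: Costa2019, Remark 3.9 (iv)] -/
theorem conj_whitingPotentialC {M a : ℝ} (hM : 0 < M) (ha : |a| < M) (s ω m lam : ℝ) {x : ℝ}
    (hr : rPlus M a < x) :
    conj (whitingPotentialC M a s ω m lam x) = whitingPotentialC M a s ω m lam x := by
  have hq : rMinus M a < x := (rMinus_le_rPlus M a).trans_lt hr
  have hx0 : 0 < x := (rPlus_pos hM a).trans hr
  have hp' : (x : ℂ) - (rPlus M a : ℂ) ≠ 0 := by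
    rw [← Complex.ofReal_sub]; exact_mod_cast (sub_pos.2 hr).ne'
  have hq' : (x : ℂ) - (rMinus M a : ℂ) ≠ 0 := by
    rw [← Complex.ofReal_sub]; exact_mod_cast (sub_pos.2 hq).ne'
  have hX' : (x : ℂ) ^ 2 + (a : ℂ) ^ 2 ≠ 0 := by
    have h : x ^ 2 + a ^ 2 ≠ 0 := by positivity
    exact_mod_cast h
  have hd' : (rPlus M a : ℂ) - (rMinus M a : ℂ) ≠ 0 := by
    rw [← Complex.ofReal_sub]
    exact_mod_cast (sub_pos.2 (IsSubextremal.rMinus_lt_rPlus ha)).ne'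
  have hM2 : (M : ℂ) = ((rPlus M a : ℂ) + (rMinus M a : ℂ)) / 2 := by
    rw [← Complex.ofReal_add, rPlus_add_rMinus]
    push_cast
    ring
  unfold whitingPotentialC tortoiseH tortoiseHDeriv liouvilleNu liouvilleNuDeriv heunQt
    innerExponent
  rw [delta_eq_mul ha.le]
  simp only [map_neg, map_mul, map_add, map_sub, map_div₀, map_pow, Complex.conj_ofReal,
    Complex.conj_I, map_one, map_ofNat]
  push_cast
  rw [hM2]
  field_simp
  ring

/-- The (real) Liouville potential `Ṽ` of Whiting's transformed equation `ũ'' + Ṽ ũ = 0`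
(Prop. 3.8 (2)); by `conj_whitingPotentialC` it is the real part of, and equal to,
`whitingPotentialC`. [cite: Costa2019, Prop. 3.8 (2), Remark 3.9 (iv)] -/
def whitingPotential (M a s ω m lam : ℝ) (x : ℝ) : ℝ :=
  (whitingPotentialC M a s ω m lam x).re

/-- `Ṽ` (real) coincides with the complex Liouville potential on `(r₊, ∞)`.
[cite: Costa2019, Remark 3.9 (iv)] -/
theorem ofReal_whitingPotential {M a : ℝ} (hM : 0 < M) (ha : |a| < M) (s ω m lam : ℝ) {x : ℝ}
    (hr : rPlus M a < x) :
    (whitingPotential M a s ω m lam x : ℂ) = whitingPotentialC M a s ω m lam x := by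
  unfold whitingPotential
  exact Complex.conj_eq_iff_re.1 (conj_whitingPotentialC hM ha s ω m lam hr)

/-! ### The first-order cancellation and the Liouville normal form -/

/-- `h' + h(2ν − P̃/Δ) = 0` on `(r₊, ∞)`: with `μ` as above the `g̃'`-terms of
`h(h(μg̃)')'` cancel against `P̃` (equivalently `h'/h + 2μ'/μ = P̃/Δ`).
[cite: Costa2019, §3.2.4 (proof of Prop. 3.8, statements 1–2)] -/
theorem tortoiseHDeriv_add_eq_zero {M a : ℝ} (hM : 0 < M) (ha : |a| < M) (s ω m : ℝ) {x : ℝ}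
    (hr : rPlus M a < x) :
    (tortoiseHDeriv M a x : ℂ) + (tortoiseH M a x : ℂ) *
      (2 * liouvilleNu M a s ω x - heunPt M a s ω m x / (delta M a x : ℂ)) = 0 := by
  have hq : rMinus M a < x := (rMinus_le_rPlus M a).trans_lt hr
  have hx0 : 0 < x := (rPlus_pos hM a).trans hr
  have h1 : (x : ℂ) - (rPlus M a : ℂ) ≠ 0 := by
    rw [← Complex.ofReal_sub]; exact_mod_cast (sub_pos.2 hr).ne'
  have h2 : (x : ℂ) - (rMinus M a : ℂ) ≠ 0 := by
    rw [← Complex.ofReal_sub]; exact_mod_cast (sub_pos.2 hq).ne'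
  have h3 : (rPlus M a : ℂ) - (rMinus M a : ℂ) ≠ 0 := by
    rw [← Complex.ofReal_sub]
    exact_mod_cast (sub_pos.2 (IsSubextremal.rMinus_lt_rPlus ha)).ne'
  have hX : (x : ℂ) ^ 2 + (a : ℂ) ^ 2 ≠ 0 := by
    have h : x ^ 2 + a ^ 2 ≠ 0 := by positivity
    exact_mod_cast h
  have hM2 : (M : ℂ) = ((rPlus M a : ℂ) + (rMinus M a : ℂ)) / 2 := by
    rw [← Complex.ofReal_add, rPlus_add_rMinus]
    push_cast
    ring
  unfold tortoiseHDeriv tortoiseH liouvilleNu heunPt innerExponent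
  rw [horizonExponent_eq hM ha, delta_eq_mul ha.le]
  push_cast
  rw [hM2]
  field_simp
  ring

/-- **Liouville normal form of `𝒯̃`** (TdC, proof of Prop. 3.8, statements (1)–(2): "The ODE for
`ũ` can be computed directly from the ODE for `g̃`"). If `Δ G'' + P̃ G' + Q̃ G = 0` at a point
`x > r₊` (`G` twice differentiable there), then `u = μ G` has
`u' = μ (G' + ν G)` and `h (h u')' + Ṽ u = 0` at `x`, i.e. `d²u/dx*² + Ṽ u = 0` for
`d/dx* = h d/dx`. [cite: Costa2019, Prop. 3.8 (2) and §3.2.4] -/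
theorem liouville_normal_form {M a : ℝ} (hM : 0 < M) (ha : |a| < M) (s ω m lam : ℝ)
    {G G₁ G₂ : ℝ → ℂ} {x : ℝ} (hr : rPlus M a < x)
    (hG : HasDerivAt G (G₁ x) x) (hG₁ : HasDerivAt G₁ (G₂ x) x)
    (hT : (delta M a x : ℂ) * G₂ x + heunPt M a s ω m x * G₁ x + heunQt M a s ω m lam x * G x = 0) :
    HasDerivAt (fun y => liouvilleMu M a s ω y * G y)
        (liouvilleMu M a s ω x * (G₁ x + liouvilleNu M a s ω x * G x)) x ∧
      ∃ w₂ : ℂ, HasDerivAt (fun y => (tortoiseH M a y : ℂ) *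
          (liouvilleMu M a s ω y * (G₁ y + liouvilleNu M a s ω y * G y))) w₂ x ∧
        (tortoiseH M a x : ℂ) * w₂ +
          whitingPotentialC M a s ω m lam x * (liouvilleMu M a s ω x * G x) = 0 := by
  have hx0 : 0 < x := (rPlus_pos hM a).trans hr
  have hXne : x ^ 2 + a ^ 2 ≠ 0 := by positivity
  have hΔ : (delta M a x : ℂ) ≠ 0 := by exact_mod_cast (delta_pos ha.le hr).ne'
  have hμ := hasDerivAt_liouvilleMu hM a s ω hr
  have hν := hasDerivAt_liouvilleNu hM a s ω hr
  have hh : HasDerivAt (fun y => (tortoiseH M a y : ℂ)) ((tortoiseHDeriv M a x : ℝ) : ℂ) x :=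
    (hasDerivAt_tortoiseH M a hXne).ofReal_comp
  have hu : HasDerivAt (fun y => liouvilleMu M a s ω y * G y)
      (liouvilleMu M a s ω x * (G₁ x + liouvilleNu M a s ω x * G x)) x :=
    (hμ.mul hG).congr_deriv (by ring)
  refine ⟨hu, ?_⟩
  -- `u₁ = μ (G₁ + ν G)` and its derivative
  have hu₁ : HasDerivAt (fun y => liouvilleMu M a s ω y * (G₁ y + liouvilleNu M a s ω y * G y))
      (liouvilleMu M a s ω x * (G₂ x + 2 * liouvilleNu M a s ω x * G₁ x +
        (liouvilleNuDeriv M a s ω x + liouvilleNu M a s ω x ^ 2) * G x)) x :=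
    (hμ.mul (hG₁.add (hν.mul hG))).congr_deriv (by
      simp only [Pi.add_apply, Pi.mul_apply]; ring)
  have hw := hh.mul hu₁
  refine ⟨_, hw, ?_⟩
  -- eliminate `G₂` with the equation and use the first-order cancellation
  have hG₂ : G₂ x = -(heunPt M a s ω m x * G₁ x + heunQt M a s ω m lam x * G x) /
      (delta M a x : ℂ) := by
    field_simp
    linear_combination hT
  have hL1 := tortoiseHDeriv_add_eq_zero hM ha s ω m hr
  rw [hG₂]
  unfold whitingPotentialC
  linear_combination (liouvilleMu M a s ω x * G₁ x * (tortoiseH M a x : ℂ)) * hL1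

/-! ### Pull-back to the tortoise variable `x*` (`x = R(x*)`, `Kerr.IsTortoiseRadius`) -/

/-- **Chain rule along a tortoise radius function.** If `R` is a tortoise radius function
(`dR/dt = h(R)`, `Kerr.IsTortoiseRadius`) and `u` has derivative `u₁(R t)` at `R t`, then
`u ∘ R` has derivative `h(R t) · u₁(R t)` at `t`: `d/dx* = h d/dx`. [cite: Costa2019, Prop. 3.8
("Introduce a new coordinate `x*` … `dx*/dx = (x²+a²)/((x−r₋)(x−r₊))`")] -/
theorem hasDerivAt_comp_tortoise {M a : ℝ} {R : ℝ → ℝ} (hR : IsTortoiseRadius M a R)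
    {u : ℝ → ℂ} {u₁ : ℂ} {t : ℝ} (hu : HasDerivAt u u₁ (R t)) :
    HasDerivAt (fun t => u (R t)) ((tortoiseH M a (R t) : ℂ) * u₁) t := by
  have h := hu.scomp t (hR.hasDerivAt t)
  simpa [Function.comp_def, tortoiseH, Complex.real_smul] using h

/-- **The transformed equation in the tortoise variable.** If `Δ G'' + P̃ G' + Q̃ G = 0` at
`R t` (`R` a tortoise radius function, `G` twice differentiable at `R t`), then
`v = (μ G) ∘ R` satisfies `v'' + Ṽ(R t) v = 0` at `t`, with `v' = [h μ (G' + νG)] ∘ R`.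
This is Prop. 3.8 (2) ("`ũ'' + Ṽũ = 0` with respect to `x* ∈ (−∞, ∞)`") as a pointwise
implication. [cite: Costa2019, Prop. 3.8 (2)] -/
theorem transformed_equation_tortoise {M a : ℝ} (hM : 0 < M) (ha : |a| < M) (s ω m lam : ℝ)
    {R : ℝ → ℝ} (hR : IsTortoiseRadius M a R) {G G₁ G₂ : ℝ → ℂ} {t : ℝ}
    (hG : HasDerivAt G (G₁ (R t)) (R t)) (hG₁ : HasDerivAt G₁ (G₂ (R t)) (R t))
    (hT : (delta M a (R t) : ℂ) * G₂ (R t) + heunPt M a s ω m (R t) * G₁ (R t) +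
      heunQt M a s ω m lam (R t) * G (R t) = 0) :
    ∃ v₂ : ℂ,
      HasDerivAt (fun t => liouvilleMu M a s ω (R t) * G (R t))
        ((tortoiseH M a (R t) : ℂ) *
          (liouvilleMu M a s ω (R t) * (G₁ (R t) + liouvilleNu M a s ω (R t) * G (R t)))) t ∧
      HasDerivAt (fun t => (tortoiseH M a (R t) : ℂ) *
          (liouvilleMu M a s ω (R t) * (G₁ (R t) + liouvilleNu M a s ω (R t) * G (R t)))) v₂ t ∧
      v₂ + (whitingPotential M a s ω m lam (R t) : ℂ) *
        (liouvilleMu M a s ω (R t) * G (R t)) = 0 := by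
  have hr : rPlus M a < R t := hR.rPlus_lt t
  obtain ⟨hu, w₂, hw₂, hode⟩ := liouville_normal_form hM ha s ω m lam hr hG hG₁ hT
  refine ⟨(tortoiseH M a (R t) : ℂ) * w₂, hasDerivAt_comp_tortoise hR hu,
    hasDerivAt_comp_tortoise hR hw₂, ?_⟩
  rw [ofReal_whitingPotential hM ha s ω m lam hr]
  exact hode

end Costa2019

end Literature.Geometry.Lorentzian.Kerr

end
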